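import Summits.Ventures.PercRepro.RankLevelSetRuleQModel

/-!
# PercRepro — THE MODEL MATROID `T_p(U_{q,F} ⊕ U_{D,D})` IN LEAN: DEFINITION AND RANK FUNCTION (night-1, gen 14; dossier §25.4 (a),
§25.5; the first step of the successor's item `ModelRecvEq`)

The matroid on a finite ground set `E` with a distinguished part `F ⊆ E` whose independent sets are the `X ⊆ E` with
`#(X ∩ F) ≤ q` and `#X ≤ p` — the truncation to rank `p` of the direct sum of the uniform matroid `U_{q,#F}` on `F` and the free
matroid on `E ∖ F` (for `#F = q + m`, `#(E ∖ F) = q + k − m`, `p = q + k` this is the matroid `M(q,k,m)` of §25.4 on which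
`recv(Z) = R̂(q,k,m)`):
* `modelIndep`, `modelMatroid` — the independence predicate and the matroid (`IndepMatroid.ofFinite`; the augmentation axiom is
  the one-line exchange: if `#(I ∩ F) < q` any element of `J ∖ I` works, otherwise `#(J ∖ F) > #(I ∖ F)` gives one outside `F`);
* `modelMatroid_indep_iff`, `modelMatroid_E`, `modelMatroid_finite`;
* **`modelMatroid_eRk`** — the rank function `r(X) = min(min(#(X ∩ F), q) + #(X ∖ F), p)` for `X ⊆ E` (`q ≤ p`);
* **`modelMatroid_mem_cellMembers_iff`** — at the tight layer `#E = p + q` the members of the cell `(p, q)` are exactly the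
  `q`-subsets `Z` of `E` with `#F ≤ q + #(Z ∩ F)`.
What remains for `ModelRecvEq` (successor): the `Y`-sets above a `q`-subset `Z` of `F` are `Z ∪ X_P ∪ X_D` with `1 ≤ #X_D ≤ p − q − 1`, the members inside
such a set number `m̂`, and the Rule Q sum is `rhat`.  Axioms: standard.
-/

namespace PercRepro

open Set Matroid

variable {α : Type}

/-- The model's independence predicate: `X ⊆ E`, `#(X ∩ F) ≤ q`, `#X ≤ p`. -/
def modelIndep (E F : Set α) (q p : ℕ) (X : Set α) : Prop :=
  X ⊆ E ∧ (X ∩ F).ncard ≤ q ∧ X.ncard ≤ p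

/-- The augmentation axiom for `modelIndep` on a finite ground set. -/
theorem modelIndep_aug {E F : Set α} (hE : E.Finite) {q p : ℕ} {I J : Set α}
    (hI : modelIndep E F q p I) (hJ : modelIndep E F q p J) (hIJ : I.ncard < J.ncard) :
    ∃ e ∈ J, e ∉ I ∧ modelIndep E F q p (insert e I) := by
  obtain ⟨hIE, hIF, hIp⟩ := hI
  obtain ⟨hJE, hJF, hJp⟩ := hJ
  have hIfin : I.Finite := hE.subset hIE
  have hJfin : J.Finite := hE.subset hJE
  by_cases hq : (I ∩ F).ncard < q
  · obtain ⟨e, heJ, heI⟩ := Set.exists_mem_notMem_of_ncard_lt_ncard hIJ hIfin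
    refine ⟨e, heJ, heI, insert_subset (hJE heJ) hIE, ?_, ?_⟩
    · calc ((insert e I) ∩ F).ncard ≤ (insert e (I ∩ F)).ncard := by
            apply Set.ncard_le_ncard _ ((hIfin.inter_of_left F).insert e)
            intro x hx
            rcases hx with ⟨hx1, hx2⟩
            rcases hx1 with rfl | hxI
            · exact mem_insert _ _
            · exact mem_insert_of_mem _ ⟨hxI, hx2⟩
        _ ≤ (I ∩ F).ncard + 1 := Set.ncard_insert_le _ _
        _ ≤ q := by omega
    · rw [Set.ncard_insert_of_notMem heI hIfin]
      omega
  · have h1 := Set.ncard_inter_add_ncard_sdiff_eq_ncard I F hIfin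
    have h2 := Set.ncard_inter_add_ncard_sdiff_eq_ncard J F hJfin
    have hlt : (I \ F).ncard < (J \ F).ncard := by omega
    obtain ⟨e, heJ, heI⟩ := Set.exists_mem_notMem_of_ncard_lt_ncard hlt (hIfin.subset Set.sdiff_subset)
    have heI' : e ∉ I := fun h => heI ⟨h, heJ.2⟩
    refine ⟨e, heJ.1, heI', insert_subset (hJE heJ.1) hIE, ?_, ?_⟩
    · have : (insert e I) ∩ F = I ∩ F := by
        ext x
        constructor
        · rintro ⟨hx1, hx2⟩
          rcases hx1 with rfl | hxI
          · exact absurd hx2 heJ.2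
          · exact ⟨hxI, hx2⟩
        · rintro ⟨hx1, hx2⟩
          exact ⟨mem_insert_of_mem _ hx1, hx2⟩
      rw [this]
      exact hIF
    · rw [Set.ncard_insert_of_notMem heI' hIfin]
      omega

/-- **The model matroid** `T_p(U_{q,F} ⊕ U_{E∖F,E∖F})` on the finite ground set `E`. -/
noncomputable def modelMatroid {E : Set α} (hE : E.Finite) (F : Set α) (q p : ℕ) : Matroid α :=
  (IndepMatroid.ofFinite hE (modelIndep E F q p)
    ⟨empty_subset _, by simp, by simp⟩
    (fun I J hJ hIJ => ⟨hIJ.trans hJ.1,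
      (Set.ncard_le_ncard (inter_subset_inter_left F hIJ) ((hE.subset hJ.1).inter_of_left F)).trans hJ.2.1,
      (Set.ncard_le_ncard hIJ (hE.subset hJ.1)).trans hJ.2.2⟩)
    (fun I J hI hJ hIJ => modelIndep_aug hE hI hJ hIJ)
    (fun I hI => hI.1)).matroid

/-- Independence in the model, unfolded: `X ⊆ E`, `#(X ∩ F) ≤ q`, `#X ≤ p`. -/
theorem modelMatroid_indep_iff {E : Set α} (hE : E.Finite) (F : Set α) (q p : ℕ) (X : Set α) :
    (modelMatroid hE F q p).Indep X ↔ X ⊆ E ∧ (X ∩ F).ncard ≤ q ∧ X.ncard ≤ p := Iff.rfl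

/-- The ground set of the model is `E`. -/
@[simp] theorem modelMatroid_E {E : Set α} (hE : E.Finite) (F : Set α) (q p : ℕ) :
    (modelMatroid hE F q p).E = E := rfl

/-- The model is a finite matroid (no `instance`: the cell's typer lint; use `haveI := modelMatroid_finite hE F q p`). -/
theorem modelMatroid_finite {E : Set α} (hE : E.Finite) (F : Set α) (q p : ℕ) :
    (modelMatroid hE F q p).Finite := ⟨hE⟩

/-- **The rank function of the model**: `r(X) = min(min(#(X ∩ F), q) + #(X ∖ F), p)` for `X ⊆ E` (with `q ≤ p`). -/
theorem modelMatroid_eRk {E : Set α} (hE : E.Finite) (F : Set α) {q p : ℕ} (hqp : q ≤ p) {X : Set α} (hX : X ⊆ E) :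
    (modelMatroid hE F q p).eRk X = ((min (min (X ∩ F).ncard q + (X \ F).ncard) p : ℕ) : ℕ∞) := by
  have hXfin : X.Finite := hE.subset hX
  apply le_antisymm
  · rw [eRk_le_iff]
    intro I hIX hI
    rw [modelMatroid_indep_iff] at hI
    obtain ⟨-, hIF, hIp⟩ := hI
    have hIfin : I.Finite := hXfin.subset hIX
    rw [← hIfin.cast_ncard_eq]
    norm_cast
    have h1 := Set.ncard_inter_add_ncard_sdiff_eq_ncard I F hIfin
    have h3 : (I ∩ F).ncard ≤ (X ∩ F).ncard :=
      Set.ncard_le_ncard (inter_subset_inter_left F hIX) (hXfin.inter_of_left F)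
    have h4 : (I \ F).ncard ≤ (X \ F).ncard :=
      Set.ncard_le_ncard (Set.sdiff_subset_sdiff_left hIX) hXfin.sdiff
    omega
  · rw [le_eRk_iff]
    set a := min (X ∩ F).ncard q with ha
    obtain ⟨A, hA, hAcard⟩ := Set.exists_subset_card_eq (show a ≤ (X ∩ F).ncard from min_le_left _ _)
    obtain ⟨B, hB, hBcard⟩ :=
      Set.exists_subset_card_eq (show min (X \ F).ncard (p - a) ≤ (X \ F).ncard from min_le_left _ _)
    have hAF : A ⊆ F := hA.trans inter_subset_right
    have hBF : Disjoint B F := disjoint_of_subset_left hB disjoint_sdiff_left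
    have hAfin : A.Finite := (hXfin.inter_of_left F).subset hA
    have hBfin : B.Finite := hXfin.sdiff.subset hB
    have hAB : Disjoint A B := by
      refine Set.disjoint_left.mpr ?_
      intro x hxA hxB
      exact hBF.notMem_of_mem_left hxB (hAF hxA)
    have hunionF : (A ∪ B) ∩ F = A := by
      ext x
      constructor
      · rintro ⟨hx1, hx2⟩
        rcases hx1 with hxA | hxB
        · exact hxA
        · exact absurd hx2 (hBF.notMem_of_mem_left hxB)
      · intro hxA
        exact ⟨Or.inl hxA, hAF hxA⟩
    have hcard : (A ∪ B).ncard = a + min (X \ F).ncard (p - a) := by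
      rw [Set.ncard_union_eq hAB hAfin hBfin, hAcard, hBcard]
    refine ⟨A ∪ B, union_subset (hA.trans inter_subset_left) (hB.trans Set.sdiff_subset), ?_, ?_⟩
    · rw [modelMatroid_indep_iff]
      refine ⟨(union_subset (hA.trans inter_subset_left) (hB.trans Set.sdiff_subset)).trans hX, ?_, ?_⟩
      · rw [hunionF, hAcard]
        exact min_le_right _ _
      · rw [hcard]
        have : a ≤ p := (min_le_right _ _).trans hqp
        omega
    · rw [← (hAfin.union hBfin).cast_ncard_eq, hcard]
      norm_cast
      have : a ≤ p := (min_le_right _ _).trans hqp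
      omega

/-- **The members of the model at the tight layer**: for `F ⊆ E`, `#E = p + q`, `q < p`, a set `Z` is a member of the cell
`(p, q)` iff `Z ⊆ E`, `#Z = q` and `#F ≤ q + #(Z ∩ F)` (equivalently `#(Z ∖ F) ≤ q − (#F − q)`: at most `q − m` points of `Z`
lie outside `F` when `#F = q + m`). -/
theorem modelMatroid_mem_cellMembers_iff {E F : Set α} (hE : E.Finite) (hF : F ⊆ E) {q p : ℕ} (hqp : q < p)
    (hEcard : E.ncard = p + q) (Z : Set α) :
    Z ∈ cellMembers (modelMatroid hE F q p) p q ↔ Z ⊆ E ∧ Z.ncard = q ∧ F.ncard ≤ q + (Z ∩ F).ncard := by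
  have hFfin : F.Finite := hE.subset hF
  constructor
  · rintro ⟨hZE, hrZ, hrC⟩
    rw [modelMatroid_E] at hZE hrC
    have hZfin : Z.Finite := hE.subset hZE
    rw [modelMatroid_eRk hE F hqp.le hZE] at hrZ
    rw [modelMatroid_eRk hE F hqp.le Set.sdiff_subset] at hrC
    have hrZ' : min (min (Z ∩ F).ncard q + (Z \ F).ncard) p = q := by exact_mod_cast hrZ
    have hrC' : min (min ((E \ Z) ∩ F).ncard q + ((E \ Z) \ F).ncard) p = p := by exact_mod_cast hrC
    have h1 := Set.ncard_inter_add_ncard_sdiff_eq_ncard Z F hZfin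
    have h2 := Set.ncard_inter_add_ncard_sdiff_eq_ncard (E \ Z) F (hE.sdiff)
    have h3 : (E \ Z).ncard = E.ncard - Z.ncard := Set.ncard_sdiff hZE hZfin
    have h4 : Z.ncard ≤ E.ncard := Set.ncard_le_ncard hZE hE
    -- #Z = q
    have hZq : Z.ncard = q := by omega
    refine ⟨hZE, hZq, ?_⟩
    -- (E ∖ Z) ∩ F = F ∖ Z and its ncard is #F − #(Z ∩ F)
    have hFZ : (E \ Z) ∩ F = F \ Z := by
      ext x
      constructor
      · rintro ⟨⟨hxE, hxZ⟩, hxF⟩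
        exact ⟨hxF, hxZ⟩
      · rintro ⟨hxF, hxZ⟩
        exact ⟨⟨hF hxF, hxZ⟩, hxF⟩
    have h5 : (F \ Z).ncard + (Z ∩ F).ncard = F.ncard := by
      have := Set.ncard_inter_add_ncard_sdiff_eq_ncard F Z hFfin
      rw [Set.inter_comm] at this
      omega
    rw [hFZ] at h2
    omega
  · rintro ⟨hZE, hZq, hFq⟩
    have hZfin : Z.Finite := hE.subset hZE
    refine ⟨by rw [modelMatroid_E]; exact hZE, ?_, ?_⟩
    · rw [modelMatroid_eRk hE F hqp.le hZE]
      have h1 := Set.ncard_inter_add_ncard_sdiff_eq_ncard Z F hZfin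
      have : min (min (Z ∩ F).ncard q + (Z \ F).ncard) p = q := by omega
      rw [this]
    · rw [modelMatroid_E, modelMatroid_eRk hE F hqp.le Set.sdiff_subset]
      have h2 := Set.ncard_inter_add_ncard_sdiff_eq_ncard (E \ Z) F (hE.sdiff)
      have h3 : (E \ Z).ncard = E.ncard - Z.ncard := Set.ncard_sdiff hZE hZfin
      have hFZ : (E \ Z) ∩ F = F \ Z := by
        ext x
        constructor
        · rintro ⟨⟨hxE, hxZ⟩, hxF⟩
          exact ⟨hxF, hxZ⟩
        · rintro ⟨hxF, hxZ⟩
          exact ⟨⟨hF hxF, hxZ⟩, hxF⟩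
      have h5 : (F \ Z).ncard + (Z ∩ F).ncard = F.ncard := by
        have := Set.ncard_inter_add_ncard_sdiff_eq_ncard F Z hFfin
        rw [Set.inter_comm] at this
        omega
      rw [hFZ] at h2
      have : min (min (F \ Z).ncard q + ((E \ Z) \ F).ncard) p = p := by omega
      rw [hFZ, this]

end PercRepro
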